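import Summits.NavierStokesRegularity.NavierStokesRegularity.Theorems.ExtremiserTransienceNearExtremalTransienceExtremiserLiouvilleConstantSpeedGlobalVariation
import Literature.Analysis.FluidPDE.RadialQuotientDerivatives
import Literature.Analysis.FunctionSpaces.SmoothParametricIntegral
import Literature.Geometry.Riemannian.ExpMapEnergyTaylor
import HarnessLib

/-!
# Crux `ExtremiserTransience.NearExtremalTransience` (stmt-NavierStokesRegularity-21883), line `extremiser_liouville`,
# stub K1b — VERTICAL SLIDING INTEGRALS: `Dᵏ((∫_{−h}^{0} G(· + te₂)dt)e₂) ∈ L²` when `DᵏG ∈ L²` (blueprint L1, tools)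

`--supports stmt-NavierStokesRegularity-21883` (helper).  Author: prover seat `ns-el-k1b` (g8).  Record:
`Cruxes/NearExtremalTransience/Lines/extremiser_liouville_k1b_slide.md` §11 (L1).  Generic `L²` tools for the discrete
slide direction `φ̂_h = g(x₂)V − g(x₂−h)V(·−he₂) − (∫_{−h}^{0} g′(x₂+t)V₂(·+te₂)dt)e₂` (`…SlideQuotient`, `…SlideQuotientL2`):
* `integrable_sq_norm_of_lintegral`, `lintegral_lt_top_of_integrable_sq_norm`, `lintegral_sq_lt_top_of_bound` : real vs
  `ℝ≥0∞` forms of `∫‖f‖² < ∞`;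
* `lintegral_iteratedFDeriv_verticalIntegral_smul_lt_top` : **`∫‖Dᵏ((∫_{−h}^{0} G(· + te₂)dt)e₂)‖² < ∞`** for `G ∈ C^∞`
  with `DᵏG ∈ L²`, `h ≥ 0` (differentiation under the integral `iteratedFDeriv_intervalIntegral_eq`, Cauchy–Schwarz on
  `[−h, 0]` (`Literature.Geometry.Riemannian.sq_intervalIntegral_le_length_mul_of_continuous`), Tonelli, translation invariance; the bound is `h²∫‖DᵏG‖²`);
* `lintegral_iteratedFDeriv_comp_add_right_eq` : translation invariance of `∫‖Dᵏ·‖²`.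

WHAT THIS IS NOT: K1b is NOT proved; nothing here proves NS regularity. [folklore]
-/

noncomputable section

open Set Filter Topology MeasureTheory Metric Function InnerProductSpace
open scoped ENNReal NNReal Topology InnerProductSpace RealInnerProductSpace ContDiff
open Literature.Analysis.FluidPDE Literature.Analysis

namespace Summit.NavierStokesRegularity.NavierStokesRegularity.Theorems

-- the problem directory repeats the summit name (`NavierStokesRegularity/NavierStokesRegularity`)
set_option linter.dupNamespace false

namespace ExtremiserLiouville

open DepletionLadder.KStar

variable {V : EuclideanSpace ℝ (Fin 3) → EuclideanSpace ℝ (Fin 3)}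

/-! ## 1. `L²` bookkeeping -/

/-- A continuous field with `∫⁻‖f‖ₑ² < ∞` has integrable `‖f‖²`. [folklore] -/
theorem integrable_sq_norm_of_lintegral {F : Type*} [NormedAddCommGroup F] {f : EuclideanSpace ℝ (Fin 3) → F}
    (hf : Continuous f) (h : ∫⁻ x, ‖f x‖ₑ ^ 2 < ⊤) : Integrable (fun x => ‖f x‖ ^ 2) := by
  refine ⟨(hf.norm.pow 2).aestronglyMeasurable, ?_⟩
  refine (hasFiniteIntegral_iff_enorm).2 (lt_of_le_of_lt (le_of_eq ?_) h)
  refine lintegral_congr fun x => ?_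
  rw [Real.enorm_eq_ofReal (sq_nonneg _), ← ofReal_norm, ENNReal.ofReal_pow (norm_nonneg _)]

/-- Conversely, integrable `‖f‖²` gives `∫⁻‖f‖ₑ² < ∞`. [folklore] -/
theorem lintegral_lt_top_of_integrable_sq_norm {F : Type*} [NormedAddCommGroup F] {f : EuclideanSpace ℝ (Fin 3) → F}
    (h : Integrable (fun x => ‖f x‖ ^ 2)) : ∫⁻ x, ‖f x‖ₑ ^ 2 < ⊤ := by
  refine lt_of_le_of_lt (le_of_eq (lintegral_congr fun x => ?_)) (hasFiniteIntegral_iff_enorm.1 h.2)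
  rw [Real.enorm_eq_ofReal (sq_nonneg _), ← ofReal_norm, ENNReal.ofReal_pow (norm_nonneg _)]

/-! ## 2. Pointwise-bound criterion -/

/-- From a pointwise bound by an integrable function to `∫⁻‖f‖ₑ² < ∞`. [folklore] -/
theorem lintegral_sq_lt_top_of_bound {F : Type*} [NormedAddCommGroup F] {f : EuclideanSpace ℝ (Fin 3) → F}
    (hf : Continuous f) {b : EuclideanSpace ℝ (Fin 3) → ℝ} (hb : Integrable b) (hle : ∀ x, ‖f x‖ ^ 2 ≤ b x) :
    ∫⁻ x, ‖f x‖ₑ ^ 2 < ⊤ :=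
  lintegral_lt_top_of_integrable_sq_norm (hb.mono' (hf.norm.pow 2).aestronglyMeasurable
    (Eventually.of_forall fun x => by rw [Real.norm_eq_abs, abs_of_nonneg (sq_nonneg _)]; exact hle x))

/-! ## 3. The sliding-integral term -/

/-- **The sliding-integral term has `Dᵏ` in `L²`**: for `G ∈ C^∞` with `DᵏG ∈ L²` and `h ≥ 0`,
`∫‖Dᵏ( (∫_{−h}^{0} G(· + te₂)dt) e₂ )‖² < ∞` (indeed `≤ h²∫‖DᵏG‖²`: differentiation under the integral,
Cauchy–Schwarz on `[−h, 0]`, Tonelli, translation invariance). [folklore] -/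
theorem lintegral_iteratedFDeriv_verticalIntegral_smul_lt_top {G : EuclideanSpace ℝ (Fin 3) → ℝ} (hG : ContDiff ℝ ∞ G)
    {k : ℕ} (hk : ∫⁻ x, ‖iteratedFDeriv ℝ k G x‖ₑ ^ 2 < ⊤) {h : ℝ} (hh : 0 ≤ h) :
    ∫⁻ x, ‖iteratedFDeriv ℝ k (fun y : EuclideanSpace ℝ (Fin 3) =>
      (∫ t in (-h)..0, G (y + t • EuclideanSpace.single (2 : Fin 3) (1 : ℝ))) • EuclideanSpace.single (2 : Fin 3) (1 : ℝ)) x‖ₑ ^ 2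
      < ⊤ := by
  set e₂ : EuclideanSpace ℝ (Fin 3) := EuclideanSpace.single (2 : Fin 3) (1 : ℝ) with he₂
  set F : EuclideanSpace ℝ (Fin 3) → ℝ := fun y => ∫ t in (-h)..0, G (y + t • e₂) with hF
  set L : ℝ →L[ℝ] EuclideanSpace ℝ (Fin 3) := (ContinuousLinearMap.id ℝ ℝ).smulRight e₂ with hL
  have hLn : ‖L‖ ≤ 1 := by
    rw [hL, ContinuousLinearMap.norm_smulRight_apply, ContinuousLinearMap.norm_id, he₂, PiLp.norm_single, norm_one,
      mul_one]
  have hfun : (fun y : EuclideanSpace ℝ (Fin 3) => F y • e₂) = ⇑L ∘ F := by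
    funext y; simp [hL]
  -- smoothness of the sliding integral
  have hunc : ContDiff ℝ ∞ (uncurry fun (y : EuclideanSpace ℝ (Fin 3)) (t : ℝ) => G (y + t • e₂)) :=
    hG.comp (contDiff_fst.add (contDiff_snd.smul contDiff_const))
  have hH : ContDiff ℝ ∞ fun q : ℝ × EuclideanSpace ℝ (Fin 3) => G (q.2 + q.1 • e₂) :=
    hG.comp (contDiff_snd.add (contDiff_fst.smul contDiff_const))
  have hFs : ContDiff ℝ ∞ F :=
    Literature.Analysis.FunctionSpaces.contDiff_parametric_intervalIntegral
      (H := fun q : ℝ × EuclideanSpace ℝ (Fin 3) => G (q.2 + q.1 • e₂)) hH (-h) 0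
  have hck : Continuous (iteratedFDeriv ℝ k G) := hG.continuous_iteratedFDeriv (WithTop.coe_le_coe.mpr le_top)
  -- pointwise: `‖Dᵏ(F e₂)(x)‖² ≤ h ∫_{-h}^{0} ‖DᵏG(x + te₂)‖² dt`
  have hpt : ∀ x, ‖iteratedFDeriv ℝ k (fun y => F y • e₂) x‖ ^ 2 ≤
      h * ∫ t in (-h)..0, ‖iteratedFDeriv ℝ k G (x + t • e₂)‖ ^ 2 := by
    intro x
    have h1 : ‖iteratedFDeriv ℝ k (fun y => F y • e₂) x‖ ≤ ‖iteratedFDeriv ℝ k F x‖ := by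
      rw [hfun, ContinuousLinearMap.iteratedFDeriv_comp_left L hFs.contDiffAt (WithTop.coe_le_coe.mpr le_top)]
      exact (ContinuousLinearMap.norm_compContinuousMultilinearMap_le _ _).trans
        (mul_le_of_le_one_left (norm_nonneg _) hLn)
    have h2 : ‖iteratedFDeriv ℝ k F x‖ ≤ ∫ t in (-h)..0, ‖iteratedFDeriv ℝ k G (x + t • e₂)‖ := by
      have h := norm_iteratedFDeriv_intervalIntegral_le (F := fun (y : EuclideanSpace ℝ (Fin 3)) (t : ℝ) => G (y + t • e₂))
        hunc (neg_nonpos.2 hh) k x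
      refine h.trans (le_of_eq (intervalIntegral.integral_congr fun t _ => ?_))
      show ‖iteratedFDeriv ℝ k (fun y : EuclideanSpace ℝ (Fin 3) => G (y + t • e₂)) x‖ = ‖iteratedFDeriv ℝ k G (x + t • e₂)‖
      rw [iteratedFDeriv_comp_add_right]
    have hφ : Continuous fun t : ℝ => ‖iteratedFDeriv ℝ k G (x + t • e₂)‖ :=
      (hck.comp (continuous_const.add (continuous_id.smul continuous_const))).norm
    have h3 := Literature.Geometry.Riemannian.sq_intervalIntegral_le_length_mul_of_continuous hφ (neg_nonpos.2 hh)
    simp only [sub_neg_eq_add, zero_add] at h3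
    have h12 : ‖iteratedFDeriv ℝ k (fun y => F y • e₂) x‖ ≤ ∫ t in (-h)..0, ‖iteratedFDeriv ℝ k G (x + t • e₂)‖ :=
      h1.trans h2
    exact (pow_le_pow_left₀ (norm_nonneg _) h12 2).trans h3
  -- the two-variable integrand and Tonelli
  set Φ : EuclideanSpace ℝ (Fin 3) → ℝ → ℝ≥0∞ := fun x t => ENNReal.ofReal (‖iteratedFDeriv ℝ k G (x + t • e₂)‖ ^ 2) with hΦ
  have hΦm : AEMeasurable (uncurry Φ) ((volume : Measure (EuclideanSpace ℝ (Fin 3))).prod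
      ((volume : Measure ℝ).restrict (Ioc (-h) 0))) := by
    refine (ENNReal.measurable_ofReal.comp (Continuous.measurable ?_)).aemeasurable
    exact ((hck.comp (continuous_fst.add (continuous_snd.smul continuous_const))).norm.pow 2)
  have hstep : ∀ x, ‖iteratedFDeriv ℝ k (fun y => F y • e₂) x‖ₑ ^ 2 ≤ ENNReal.ofReal h * ∫⁻ t in Ioc (-h) 0, Φ x t := by
    intro x
    have hc : Continuous fun t : ℝ => ‖iteratedFDeriv ℝ k G (x + t • e₂)‖ ^ 2 :=
      ((hck.comp (continuous_const.add (continuous_id.smul continuous_const))).norm.pow 2)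
    have hi : IntegrableOn (fun t : ℝ => ‖iteratedFDeriv ℝ k G (x + t • e₂)‖ ^ 2) (Ioc (-h) 0) volume :=
      (hc.integrableOn_Icc (a := -h) (b := 0)).mono_set Ioc_subset_Icc_self
    rw [← ofReal_norm, ← ENNReal.ofReal_pow (norm_nonneg _)]
    calc ENNReal.ofReal (‖iteratedFDeriv ℝ k (fun y => F y • e₂) x‖ ^ 2)
        ≤ ENNReal.ofReal (h * ∫ t in (-h)..0, ‖iteratedFDeriv ℝ k G (x + t • e₂)‖ ^ 2) := ENNReal.ofReal_le_ofReal (hpt x)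
      _ = ENNReal.ofReal h * ∫⁻ t in Ioc (-h) 0, Φ x t := by
          rw [ENNReal.ofReal_mul hh, intervalIntegral.integral_of_le (neg_nonpos.2 hh),
            ofReal_integral_eq_lintegral_ofReal hi (Eventually.of_forall fun t => sq_nonneg _)]
  have hvol : (volume : Measure ℝ) (Ioc (-h) 0) = ENNReal.ofReal h := by
    rw [Real.volume_Ioc, sub_neg_eq_add, zero_add]
  have htrans : ∀ t : ℝ, ∫⁻ x, Φ x t = ∫⁻ y, ‖iteratedFDeriv ℝ k G y‖ₑ ^ 2 := by
    intro t
    have e := lintegral_add_right_eq_self (μ := (volume : Measure (EuclideanSpace ℝ (Fin 3))))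
      (fun y => ENNReal.ofReal (‖iteratedFDeriv ℝ k G y‖ ^ 2)) (t • e₂)
    simp only [hΦ]
    rw [e]
    refine lintegral_congr fun y => ?_
    rw [← ofReal_norm, ← ENNReal.ofReal_pow (norm_nonneg _)]
  calc ∫⁻ x, ‖iteratedFDeriv ℝ k (fun y => F y • e₂) x‖ₑ ^ 2
      ≤ ∫⁻ x, ENNReal.ofReal h * ∫⁻ t in Ioc (-h) 0, Φ x t := lintegral_mono hstep
    _ = ENNReal.ofReal h * ∫⁻ x, ∫⁻ t in Ioc (-h) 0, Φ x t := by
        rw [lintegral_const_mul' _ _ ENNReal.ofReal_ne_top]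
    _ = ENNReal.ofReal h * ∫⁻ t in Ioc (-h) 0, ∫⁻ x, Φ x t := by rw [lintegral_lintegral_swap hΦm]
    _ = ENNReal.ofReal h * ∫⁻ _t in Ioc (-h) 0, ∫⁻ y, ‖iteratedFDeriv ℝ k G y‖ₑ ^ 2 := by
        congr 1; exact setLIntegral_congr_fun measurableSet_Ioc fun t _ => htrans t
    _ = ENNReal.ofReal h * (ENNReal.ofReal h * ∫⁻ y, ‖iteratedFDeriv ℝ k G y‖ₑ ^ 2) := by
        rw [setLIntegral_const, hvol, mul_comm (∫⁻ y, ‖iteratedFDeriv ℝ k G y‖ₑ ^ 2)]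
    _ < ⊤ := ENNReal.mul_lt_top ENNReal.ofReal_lt_top (ENNReal.mul_lt_top ENNReal.ofReal_lt_top hk)

/-! ## 4. Translation invariance -/

/-- Translation invariance of `∫‖Dᵏ·‖²`. [folklore] -/
theorem lintegral_iteratedFDeriv_comp_add_right_eq {F : Type*} [NormedAddCommGroup F] [NormedSpace ℝ F]
    (Ψ : EuclideanSpace ℝ (Fin 3) → F) (a : EuclideanSpace ℝ (Fin 3)) (k : ℕ) :
    ∫⁻ x, ‖iteratedFDeriv ℝ k (fun y => Ψ (y + a)) x‖ₑ ^ 2 = ∫⁻ x, ‖iteratedFDeriv ℝ k Ψ x‖ₑ ^ 2 := by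
  have htr : ∀ x, iteratedFDeriv ℝ k (fun y => Ψ (y + a)) x = iteratedFDeriv ℝ k Ψ (x + a) := fun x => by
    rw [iteratedFDeriv_comp_add_right]
  simp_rw [htr]
  exact lintegral_add_right_eq_self (μ := (volume : Measure (EuclideanSpace ℝ (Fin 3))))
    (fun y => ‖iteratedFDeriv ℝ k Ψ y‖ₑ ^ 2) a


end ExtremiserLiouville

end Summit.NavierStokesRegularity.NavierStokesRegularity.Theorems

end
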